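import Summits.KontsevichZagierPeriods.Zeta5Search.Barrier.ConeGammaNCapKernel

/-!
# ζ(5) search — BARRIER: the sharp cap `𝒩 ≤ 5`, combinatorial core (monotone data ⇒ spread ≤ 5)

HONEST FRAMING (cell `pub-zeta5`): systematic search; no irrationality claim unless kernel-certified. Pure finite
combinatorics serving `ConeGammaNCap5` (theory seat cert-2 g19, lead line 2026-08-23T13:25Z). Nothing about `ζ(5)`.

From `ConeGammaNCapKernel` (the kernel-checked table of the 64 doubly-monotone patterns) to the abstract statement used by
the real-variable file: if a symmetric marking `hv` of pairs of `{0..6}` is MONOTONE in both arguments (the threshold graph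
of sorted weights) and the end marking `hi` is monotone (a top segment), then `W(P) ≤ W(P') + 5` for all Hamiltonian paths
`P, P'` of `{0..6}` (`W` = marked consecutive pairs + marked ends, `NCap.wVal`).

* `firstFrom` (least marked index of a final segment) and its specification; `tauOf` — the pattern of a monotone marking,
  `hv p q = (τ p ≤ q)` for `p < q`; the column condition `τ(p+1) ≤ max(τ p, p+2)`;
* `genFrom`/`adm`/`mem_genFrom` — a structural generator of the admissible patterns, complete by induction, and
  `genFrom_eq_taus64` (`decide`): the admissible patterns are exactly the 64 of the kernel file;
* **`wVal_spread_le_five`** — the abstract cap.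
-/

namespace Summit.KontsevichZagierPeriods.Zeta5Search.Barrier.ConeGamma.NCap

/-! ### Least marked index of a final segment -/

/-- The least `q` with `st ≤ q < 7` and `f q`, else `7` (fuel `n`; use `n ≥ 7 − st`). -/
def firstFrom (f : ℕ → Bool) : ℕ → ℕ → ℕ
  | _, 0 => 7
  | st, n + 1 => if 7 ≤ st then 7 else if f st then st else firstFrom f (st + 1) n

/-- `firstFrom ≤ 7`. -/
theorem firstFrom_le (f : ℕ → Bool) : ∀ (n st : ℕ), firstFrom f st n ≤ 7 := by
  intro n; induction n with
  | zero => intro st; simp [firstFrom]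
  | succ n ih => intro st; unfold firstFrom; split_ifs <;> first | omega | exact ih _

/-- `st ≤ firstFrom` when `st ≤ 7`. -/
theorem le_firstFrom (f : ℕ → Bool) : ∀ (n st : ℕ), st ≤ 7 → st ≤ firstFrom f st n := by
  intro n; induction n with
  | zero => intro st h; simp [firstFrom]; omega
  | succ n ih =>
    intro st h; unfold firstFrom
    split_ifs with h1 h2
    · omega
    · exact le_rfl
    · exact le_trans (Nat.le_succ st) (ih (st + 1) (by omega))

/-- If `f q` for some `st ≤ q < 7` (within the fuel) then `firstFrom ≤ q`. -/
theorem firstFrom_le_of (f : ℕ → Bool) : ∀ (n st q : ℕ), st ≤ q → q < 7 → q < st + n → f q = true →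
    firstFrom f st n ≤ q := by
  intro n; induction n with
  | zero => intro st q h1 h2 h3; omega
  | succ n ih =>
    intro st q h1 h2 h3 hq
    unfold firstFrom
    split_ifs with h4 h5
    · omega
    · exact h1
    · rcases Nat.eq_or_lt_of_le h1 with rfl | hlt
      · exact absurd hq (by simp [h5])
      · exact ih (st + 1) q hlt h2 (by omega) hq

/-- If `firstFrom < 7` then `f (firstFrom) = true`. -/
theorem f_firstFrom (f : ℕ → Bool) : ∀ (n st : ℕ), firstFrom f st n < 7 → f (firstFrom f st n) = true := by
  intro n; induction n with
  | zero => intro st h; simp [firstFrom] at h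
  | succ n ih =>
    intro st h
    unfold firstFrom at h ⊢
    split_ifs at h ⊢ with h4 h5
    · omega
    · exact h5
    · exact ih _ h

/-- For a marking MONOTONE on `[st, 7)`, membership is a threshold: `f q ↔ firstFrom ≤ q`. -/
theorem eq_decide_firstFrom_le (f : ℕ → Bool) (st : ℕ) (hmono : ∀ q q', st ≤ q → q ≤ q' → q' < 7 → f q = true → f q' = true)
    {q : ℕ} (hlo : st ≤ q) (hq : q < 7) : f q = decide (firstFrom f st 7 ≤ q) := by
  by_cases h : firstFrom f st 7 ≤ q
  · rw [decide_eq_true h]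
    have h7 : firstFrom f st 7 < 7 := lt_of_le_of_lt h hq
    exact hmono _ _ (le_firstFrom f 7 st (by omega)) h hq (f_firstFrom f 7 st h7)
  · rw [decide_eq_false h]
    by_contra hc
    rw [Bool.not_eq_false] at hc
    exact h (firstFrom_le_of f 7 st q hlo hq (by omega) hc)

/-! ### The pattern of a doubly-monotone marking -/

/-- `τ p` = least `q > p` with `hv p q`, else `7`. -/
def tauOf (hv : ℕ → ℕ → Bool) (p : ℕ) : ℕ := firstFrom (hv p) (p + 1) 7

/-- The pattern list `[τ 0, …, τ 6]`. -/
def tauList (hv : ℕ → ℕ → Bool) : List ℕ := (List.range 7).map (tauOf hv)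

/-- Entries of the pattern list. -/
theorem tauList_getD (hv : ℕ → ℕ → Bool) {p : ℕ} (hp : p < 7) : (tauList hv).getD p 7 = tauOf hv p := by
  unfold tauList
  rw [List.getD_eq_getElem?_getD, List.getElem?_map, List.getElem?_range hp]
  rfl

section mono
variable (hv : ℕ → ℕ → Bool)
  (hsym : ∀ p q, hv p q = hv q p)
  (hrow : ∀ p q q', p < q → q ≤ q' → q' < 7 → hv p q = true → hv p q' = true)
  (hcol : ∀ p p' q, p ≤ p' → p' < q → q < 7 → hv p q = true → hv p' q = true)
include hrow in
/-- Row threshold: for `p < q < 7`, `hv p q = (τ p ≤ q)`. -/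
theorem hv_eq_decide {p q : ℕ} (hpq : p < q) (hq : q < 7) : hv p q = decide (tauOf hv p ≤ q) :=
  eq_decide_firstFrom_le (hv p) (p + 1) (fun q q' h1 h2 h3 h4 => hrow p q q' (by omega) h2 h3 h4) hpq hq

/-- `p + 1 ≤ τ p ≤ 7`. -/
theorem tauOf_bounds (p : ℕ) (hp : p < 7) : p + 1 ≤ tauOf hv p ∧ tauOf hv p ≤ 7 :=
  ⟨le_firstFrom _ 7 (p + 1) (by omega), firstFrom_le _ 7 _⟩

include hrow hcol in
/-- Column condition: `τ (p+1) ≤ max (τ p) (p+2)`. -/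
theorem tauOf_succ_le (p : ℕ) (hp : p + 1 < 7) : tauOf hv (p + 1) ≤ max (tauOf hv p) (p + 2) := by
  by_cases h7 : max (tauOf hv p) (p + 2) < 7
  · -- `q' = max (τ p) (p+2)` is heavy for `p`, hence for `p+1`
    have ht : tauOf hv p < 7 := lt_of_le_of_lt (le_max_left _ _) h7
    have hpt : p < tauOf hv p := by have := (tauOf_bounds hv p (by omega)).1; omega
    have h1 : hv p (tauOf hv p) = true := by
      have := hv_eq_decide hv hrow hpt ht; simpa using this
    have h2 : hv p (max (tauOf hv p) (p + 2)) = true := hrow p _ _ hpt (le_max_left _ _) h7 h1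
    have h3 : hv (p + 1) (max (tauOf hv p) (p + 2)) = true :=
      hcol p (p + 1) _ (Nat.le_succ p) (by omega) h7 h2
    have h4 := hv_eq_decide hv hrow (p := p + 1) (q := max (tauOf hv p) (p + 2)) (by omega) h7
    rw [h3] at h4
    exact of_decide_eq_true h4.symm
  · exact le_trans (tauOf_bounds hv (p + 1) hp).2 (by omega)

include hsym hrow in
/-- The kernel file's `heavy (tauList hv)` agrees with `hv` off the diagonal. -/
theorem heavy_tauList_eq {p q : ℕ} (hp : p < 7) (hq : q < 7) (hpq : p ≠ q) : heavy (tauList hv) p q = hv p q := by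
  unfold heavy
  rcases lt_or_gt_of_ne hpq with h | h
  · rw [if_pos h, tauList_getD hv hp, ← hv_eq_decide hv hrow h hq]
  · rw [if_neg (lt_asymm h), if_pos h, tauList_getD hv hq, ← hv_eq_decide hv hrow h hp, hsym]
end mono

/-! ### The admissible patterns are the 64 of the kernel file -/

/-- Admissible tails from position `p` with previous value `prev` (a Boolean test). -/
def adm : ℕ → ℕ → List ℕ → Bool
  | _, _, [] => true
  | p, prev, t :: L => decide (p + 1 ≤ t) && decide (t ≤ 7) && decide (t ≤ max prev (p + 1)) && adm (p + 1) t L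

/-- Structural generator of the admissible tails of length `n`. -/
def genFrom : ℕ → ℕ → ℕ → List (List ℕ)
  | _, _, 0 => [[]]
  | p, prev, n + 1 => ((List.range 8).filter fun t => decide (p + 1 ≤ t) && decide (t ≤ max prev (p + 1))).flatMap
      fun t => (genFrom (p + 1) t n).map fun L => t :: L

/-- Completeness of the generator. -/
theorem mem_genFrom : ∀ (L : List ℕ) (p prev : ℕ), adm p prev L = true → L ∈ genFrom p prev L.length := by
  intro L; induction L with
  | nil => intro p prev _; simp [genFrom]
  | cons t L ih =>
    intro p prev h
    simp only [adm, Bool.and_eq_true, decide_eq_true_eq] at h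
    obtain ⟨⟨⟨h1, h2⟩, h3⟩, h4⟩ := h
    simp only [List.length_cons, genFrom, List.mem_flatMap, List.mem_filter, List.mem_range, List.mem_map,
      List.cons.injEq, Bool.and_eq_true, decide_eq_true_eq]
    exact ⟨t, ⟨by omega, h1, h3⟩, L, ih (p + 1) t h4, rfl, rfl⟩

/-- The admissible patterns of length 7 are exactly `taus64`. -/
theorem genFrom_eq_taus64 : genFrom 0 7 7 = taus64 := by decide

section adm
variable (hv : ℕ → ℕ → Bool)
  (hrow : ∀ p q q', p < q → q ≤ q' → q' < 7 → hv p q = true → hv p q' = true)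
  (hcol : ∀ p p' q, p ≤ p' → p' < q → q < 7 → hv p q = true → hv p' q = true)
include hrow hcol in
/-- The pattern list of a doubly-monotone marking is admissible. -/
theorem adm_tauList : adm 0 7 (tauList hv) = true := by
  have hb := fun p hp => tauOf_bounds hv p hp
  have hc := fun p hp => tauOf_succ_le hv hrow hcol p hp
  have e : tauList hv = [tauOf hv 0, tauOf hv 1, tauOf hv 2, tauOf hv 3, tauOf hv 4, tauOf hv 5, tauOf hv 6] := by
    simp [tauList, List.range, List.range.loop]
  rw [e]
  simp only [adm, Bool.and_eq_true, decide_eq_true_eq, Bool.and_true]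
  refine ⟨⟨⟨(hb 0 (by omega)).1, (hb 0 (by omega)).2⟩, le_trans (hb 0 (by omega)).2 (by omega)⟩, ?_⟩
  refine ⟨⟨⟨(hb 1 (by omega)).1, (hb 1 (by omega)).2⟩, hc 0 (by omega)⟩, ?_⟩
  refine ⟨⟨⟨(hb 2 (by omega)).1, (hb 2 (by omega)).2⟩, hc 1 (by omega)⟩, ?_⟩
  refine ⟨⟨⟨(hb 3 (by omega)).1, (hb 3 (by omega)).2⟩, hc 2 (by omega)⟩, ?_⟩
  refine ⟨⟨⟨(hb 4 (by omega)).1, (hb 4 (by omega)).2⟩, hc 3 (by omega)⟩, ?_⟩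
  refine ⟨⟨⟨(hb 5 (by omega)).1, (hb 5 (by omega)).2⟩, hc 4 (by omega)⟩, ?_⟩
  exact ⟨⟨(hb 6 (by omega)).1, (hb 6 (by omega)).2⟩, hc 5 (by omega)⟩

include hrow hcol in
/-- Hence it is one of the 64 kernel-checked patterns. -/
theorem tauList_mem_taus64 : tauList hv ∈ taus64 := by
  have hlen : (tauList hv).length = 7 := by simp [tauList]
  have := mem_genFrom (tauList hv) 0 7 (adm_tauList hv hrow hcol)
  rwa [hlen, genFrom_eq_taus64] at this
end adm

/-! ### Monotone end marking = top segment; congruence of `W` -/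

/-- `hcount` only looks at pairs of DISTINCT members when the sequence has no duplicates. -/
theorem hcount_congr (hv hv' : ℕ → ℕ → Bool) : ∀ (P : List ℕ), P.Nodup →
    (∀ a ∈ P, ∀ b ∈ P, a ≠ b → hv a b = hv' a b) → hcount hv P = hcount hv' P := by
  intro P; induction P with
  | nil => intros; rfl
  | cons a P ih =>
    intro hnd h
    rcases P with _ | ⟨b, P⟩
    · rfl
    · have hab : a ≠ b := by intro e; subst e; simp at hnd
      have h1 : hv a b = hv' a b := h a (by simp) b (by simp) hab
      have h2 := ih (List.nodup_cons.mp hnd).2 (fun x hx y hy hxy => h x (by simp [hx]) y (by simp [hy]) hxy)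
      simp only [hcount, h1, h2]

/-- `W` congruence on a duplicate-free sequence. -/
theorem wVal_congr (hv hv' : ℕ → ℕ → Bool) (hi hi' : ℕ → Bool) {P : List ℕ} (hnd : P.Nodup)
    (h : ∀ a ∈ P, ∀ b ∈ P, a ≠ b → hv a b = hv' a b) (h' : ∀ a ∈ P, hi a = hi' a) :
    wVal hv hi P = wVal hv' hi' P := by
  unfold wVal
  rw [hcount_congr hv hv' P hnd h]
  rcases P with _ | ⟨a, P⟩
  · rfl
  · have e1 : (a :: P).head? = some a := rfl
    rw [e1]
    cases hl : (a :: P).getLast? with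
    | none => simp at hl
    | some b =>
      have hb : b ∈ a :: P := List.mem_of_getLast? hl
      simp only [h' a (by simp), h' b hb]

/-- **THE ABSTRACT CAP.** For a symmetric pair marking of `{0..6}` monotone in both arguments and a monotone end marking,
`W(P) ≤ W(P') + 5` for all Hamiltonian paths `P, P'` of `{0..6}`. -/
theorem wVal_spread_le_five (hv : ℕ → ℕ → Bool) (hi : ℕ → Bool)
    (hsym : ∀ p q, hv p q = hv q p)
    (hrow : ∀ p q q', p < q → q ≤ q' → q' < 7 → hv p q = true → hv p q' = true)
    (hcol : ∀ p p' q, p ≤ p' → p' < q → q < 7 → hv p q = true → hv p' q = true)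
    (hhi : ∀ v v', v ≤ v' → v' < 7 → hi v = true → hi v' = true)
    {P P' : List ℕ} (hP : P.Perm (List.range 7)) (hP' : P'.Perm (List.range 7)) :
    wVal hv hi P ≤ wVal hv hi P' + 5 := by
  -- the end marking is the top segment `{v | m ≤ v}`, `m = firstFrom hi 0 7`; put `k = 7 - m`
  set m := firstFrom hi 0 7 with hm
  have hm7 : m ≤ 7 := firstFrom_le hi 7 0
  have hiseg : ∀ v, v < 7 → hi v = decide (7 ≤ v + (7 - m)) := by
    intro v hv7
    rw [eq_decide_firstFrom_le hi 0 (fun q q' _ h2 h3 h4 => hhi q q' h2 h3 h4) (Nat.zero_le v) hv7]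
    by_cases h : firstFrom hi 0 7 ≤ v
    · rw [decide_eq_true h, decide_eq_true (by omega)]
    · rw [decide_eq_false h, decide_eq_false (by omega)]
  -- replace the data by the kernel file's pattern data
  have hmemP : ∀ {Q : List ℕ}, Q.Perm (List.range 7) → ∀ a ∈ Q, a < 7 := fun hQ a ha =>
    List.mem_range.mp (hQ.mem_iff.mp ha)
  have hcongr : ∀ {Q : List ℕ}, Q.Perm (List.range 7) →
      wVal hv hi Q = wVal (heavy (tauList hv)) (fun v => decide (7 ≤ v + (7 - m))) Q := by
    intro Q hQ
    refine wVal_congr _ _ _ _ (hQ.nodup_iff.mpr List.nodup_range) (fun a ha b hb hab => ?_) (fun a ha => ?_)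
    · exact (heavy_tauList_eq hv hsym hrow (hmemP hQ a ha) (hmemP hQ b hb) hab).symm
    · exact hiseg a (hmemP hQ a ha)
  rw [hcongr hP, hcongr hP']
  exact wVal_sub_le_five_of_checkTau (checkTau_of_mem_taus64 (tauList_mem_taus64 hv hrow hcol)) (k := 7 - m)
    (by omega) hP hP'

end Summit.KontsevichZagierPeriods.Zeta5Search.Barrier.ConeGamma.NCap
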